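import Summits.KontsevichZagierPeriods.KontsevichZagierPeriods.Theses.HurwitzMicroSectors
import Summits.KontsevichZagierPeriods.KontsevichZagierPeriods.Theorems.HurwitzMicroSectorsNormalFormPrinciplePiBoxTransfer

/-! TTRL-lite variant V2205 of stmt-KontsevichZagierPeriods-3869

Variant V2205 = `stub_boxRigidity` (BoxRigidity: two box-rational representations — domain the open
unit box, integrand `p/q` over `ℚ` — with equal values are KZ-equivalent) under the TWO-sided
small-case move `bound_nat:m≤2; bound_nat:m'≤2`. Verdict of the attempt seat: **open** — this file is
the exact-strength certificate, not a proof of the variant. A two-sided bound is a genuine weakening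
of the leaf (unlike the one-sided bounds, files `…Variants2200/2219/2256`), and its strength is that of
its largest dimension: padding by unit intervals (`pad_le`) and subtracting on the common box
(`sub_same`) — packaged in the tree as `boxRigidityLe_of_boxVanishingAt` /
`boxVanishingAt_of_boxRigidityAt` (file `…Variants2204`; the general joint-bound form
`boxRigidityLe_iff_boxVanishing j k`, dimension `max j k`, is in file `…Variants2239`) — give

  `V2205 ⟺ BoxVanishing 2 ⟺ BoxRigidity₍₂,₂₎ ⟺ V2204`

(`stub_boxRigidity_var2205_iff_boxVanishing_two`, `…_iff_dim_two`, `…_iff_var2204`), where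
`BoxVanishing 2` is Conjecture 1 in kernel form on ALL box-rational representations of the open unit
SQUARE (`∀ N : IntegralRep 2`, `N.value = 0 → [N] ∈ KZ.relations`). Its dimension-`≤ 1` part is a
theorem of the tree (`boxRigidity_of_le_one`, Baker); the square is the first open dimension: V2205
would close every weight-two Hurwitz rung `P(xy)/(1 − (xy)ᴸ)` with NO independence input
(`sectorTwo_of_stub_boxRigidity_var2205`), in particular the Catalan rung (level 4), which the route
closes only under the open hypothesis `Indep_ℚ(1, π², G)`; for every `q : ℚ` it contains
"`G = q ⇒ [1/(1+x²y²) − q]_□ ∈ relations`", provable today only through the irrationality of Catalan's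
constant (open) or an explicit chain of moves (none known). Conversely `KontsevichZagierPeriods → V2205`
(`stub_boxRigidity_var2205_of_statement`), so a refutation would refute the Summit; the
dimension-3 siblings V2238/V2239 imply V2205 (`boxVanishing_two_of_stub_boxRigidity_var2239`, tree).
Source: M. Kontsevich, D. Zagier, *Periods* (2001), §1.2 Conjecture 1. Pure proof file, no definitions. -/

-- `Summit.<Summit>.<Problem>` is the tree's mandated summit-side namespace (CONVENTIONS §2); for this
-- single-conjunct summit the two coincide, so the duplicate is deliberate.
set_option linter.dupNamespace false

noncomputable section

namespace Summit.KontsevichZagierPeriods.KontsevichZagierPeriods.Theorems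

open MeasureTheory Set
open Literature.NumberTheory.Transcendental Literature.NumberTheory.Transcendental.KZ
open Summit.KontsevichZagierPeriods.KontsevichZagierPeriods.Theses.HurwitzMicroSectors
open Summit.KontsevichZagierPeriods.HurwitzMicroSectors.NormalFormPrinciple.PiBox
open Summit.KontsevichZagierPeriods.HurwitzMicroSectors.NormalFormPrinciple.PiBox.stub_boxCombineAux
  (pad_le sub_same)

/-! ## Local copies of the padding lemmas (public versions: files `…Variants2204`, `…Variants2239`) -/

/-- BoxVanishing at dimension `K` ⇒ BoxRigidity for all `m, m' ≤ K` (pad both to the `K`-box by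
`pad_le`, subtract on it by `sub_same`; the difference has value `0` by soundness). Local copy of
`boxRigidityLe_of_boxVanishingAt` (file `…Variants2204`). [cite: KontsevichZagier2001, §1.2] -/
private theorem rigidityLe_of_vanishingAt (K : ℕ)
    (hvan : ∀ N : IntegralRep K, N.domain = {x | ∀ i, x i ∈ Set.Ioo (0:ℝ) 1} → N.IsRational →
      N.value = 0 → of N ∈ relations)
    {m m' : ℕ} (hm : m ≤ K) (hm' : m' ≤ K) (N : IntegralRep m) (N' : IntegralRep m')
    (hNd : N.domain = {x | ∀ i, x i ∈ Set.Ioo (0:ℝ) 1}) (hNr : N.IsRational)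
    (hN'd : N'.domain = {x | ∀ i, x i ∈ Set.Ioo (0:ℝ) 1}) (hN'r : N'.IsRational)
    (hv : N.value = N'.value) : Equivalent N N' := by
  obtain ⟨R₁, h₁d, h₁r, h₁⟩ := pad_le hm N hNd hNr
  obtain ⟨R₂, h₂d, h₂r, h₂⟩ := pad_le hm' N' hN'd hN'r
  obtain ⟨M, hMd, hMr, hM⟩ := sub_same R₁ R₂ h₁d h₁r h₂d h₂r
  have e₁ := relations_le_ker_eval_holds h₁
  have e₂ := relations_le_ker_eval_holds h₂
  have e := relations_le_ker_eval_holds hM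
  simp only [AddMonoidHom.mem_ker, map_sub, eval_of] at e₁ e₂ e
  have hMv : M.value = 0 := by linarith
  have hsplit : of N - of N' = (of N - of R₁) - (of N' - of R₂) + (of R₁ - of R₂ - of M) + of M := by
    abel
  show of N - of N' ∈ relations
  rw [hsplit]
  exact relations.add_mem (relations.add_mem (relations.sub_mem h₁ h₂) hM) (hvan M hMd hMr hMv)

/-- BoxRigidity for pairs of dimension `K` ⇒ BoxVanishing at `K` (compare with the zero representation
on the `K`-box). Local copy of `boxVanishingAt_of_boxRigidityAt` (file `…Variants2204`).
[cite: KontsevichZagier2001, §1.2] -/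
private theorem vanishingAt_of_rigidityAt (K : ℕ)
    (hrig : ∀ N N' : IntegralRep K, N.domain = {x | ∀ i, x i ∈ Set.Ioo (0:ℝ) 1} → N.IsRational →
      N'.domain = {x | ∀ i, x i ∈ Set.Ioo (0:ℝ) 1} → N'.IsRational → N.value = N'.value →
      Equivalent N N')
    (N : IntegralRep K) (hNd : N.domain = {x | ∀ i, x i ∈ Set.Ioo (0:ℝ) 1}) (hNr : N.IsRational)
    (hv : N.value = 0) : of N ∈ relations := by
  obtain ⟨Z, hZd, hZi⟩ := exists_zeroRep (isSemialgebraic_box K)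
  have hZ : of Z ∈ relations := of_mem_relations_of_eqOn_zero Z (by simp [hZi, EqOn])
  have hZv : Z.value = 0 := by simp [IntegralRep.value, hZi]
  have hZr : Z.IsRational := ⟨0, 1, fun x _ => by simp, fun x _ => by simp [hZi]⟩
  have h : of N - of Z ∈ relations := hrig N Z hNd hNr hZd hZr (by rw [hv, hZv])
  have := relations.add_mem h hZ
  rwa [sub_add_cancel] at this

/-- BoxVanishing at `K` ⇒ BoxVanishing at every `m ≤ K` (pad; the value is kept by soundness). Local
copy of `boxVanishingLe_of_boxVanishingAt` (file `…Variants2204`). [cite: KontsevichZagier2001, §1.2] -/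
private theorem vanishingLe_of_vanishingAt (K : ℕ)
    (hvan : ∀ N : IntegralRep K, N.domain = {x | ∀ i, x i ∈ Set.Ioo (0:ℝ) 1} → N.IsRational →
      N.value = 0 → of N ∈ relations)
    {m : ℕ} (hm : m ≤ K) (N : IntegralRep m) (hNd : N.domain = {x | ∀ i, x i ∈ Set.Ioo (0:ℝ) 1})
    (hNr : N.IsRational) (hv : N.value = 0) : of N ∈ relations := by
  obtain ⟨R, hRd, hRr, hR⟩ := pad_le hm N hNd hNr
  have e := relations_le_ker_eval_holds hR
  simp only [AddMonoidHom.mem_ker, map_sub, eval_of] at e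
  have hRv : R.value = 0 := by linarith
  have := relations.add_mem hR (hvan R hRd hRr hRv)
  rwa [sub_add_cancel] at this

/-- A representation on the open square with integrand `P(x₀x₁)/(1 − (x₀x₁)ᴸ)` (`L ≠ 0`) has KZ's
rational shape. Local copy of `isRational_of_sectorTwo` (file `…Variants2204`). [cite: KontsevichZagier2001, §1.1] -/
private theorem isRational_sectorTwo (L : ℕ) (hL : L ≠ 0) (r : IntegralRep 2) (P : Polynomial ℚ)
    (hr : r.domain = {x | ∀ i, x i ∈ Set.Ioo (0:ℝ) 1})
    (hP : EqOn r.integrand (fun x => Polynomial.aeval (x 0 * x 1) P / (1 - (x 0 * x 1) ^ L)) r.domain) :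
    r.IsRational := by
  refine ⟨Polynomial.aeval (MvPolynomial.X 0 * MvPolynomial.X 1 : MvPolynomial (Fin 2) ℚ) P,
    1 - (MvPolynomial.X 0 * MvPolynomial.X 1) ^ L, fun x hx => ?_, fun x hx => ?_⟩
  · rw [hr] at hx
    simp only [mem_setOf_eq] at hx
    have h0 := hx 0
    have h1 := hx 1
    simp only [map_sub, map_one, map_pow, map_mul, MvPolynomial.aeval_X]
    have ht0 : 0 ≤ x 0 * x 1 := mul_nonneg h0.1.le h1.1.le
    have ht1 : x 0 * x 1 < 1 := mul_lt_one_of_nonneg_of_lt_one_left h0.1.le h0.2 h1.2.le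
    exact (sub_pos.2 (pow_lt_one₀ ht0 ht1 hL)).ne'
  · show r.integrand x = MvPolynomial.aeval x (Polynomial.aeval _ P) / MvPolynomial.aeval x _
    rw [hP hx, ← Polynomial.aeval_algHom_apply]
    simp

/-! ## The variant V2205: Conjecture 1 for box-rational periods of the square -/

/-- **V2205 ⟺ BoxVanishing 2**: the two-sided bound `m, m' ≤ 2` of `stub_boxRigidity` is exactly the
statement that every box-rational representation on the open unit square of value `0` is a relation
(pad to the square and subtract there one way; compare with the zero representation the other way).
[cite: KontsevichZagier2001, §1.2 Conjecture 1] -/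
theorem stub_boxRigidity_var2205_iff_boxVanishing_two :
    (∀ (m m' : ℕ) (N : IntegralRep m) (N' : IntegralRep m'), m' ≤ 2 → m ≤ 2 → N.domain = {x | ∀ i, x i ∈ Set.Ioo (0:ℝ) 1} → N.IsRational → N'.domain = {x | ∀ i, x i ∈ Set.Ioo (0:ℝ) 1} → N'.IsRational → N.value = N'.value → Equivalent N N') ↔
    (∀ N : IntegralRep 2, N.domain = {x | ∀ i, x i ∈ Set.Ioo (0:ℝ) 1} → N.IsRational →
      N.value = 0 → of N ∈ relations) :=
  ⟨fun h => vanishingAt_of_rigidityAt 2 fun N N' => h 2 2 N N' le_rfl le_rfl,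
    fun h _ _ N N' hm' hm => rigidityLe_of_vanishingAt 2 h hm hm' N N'⟩

/-- **V2205 ⟺ box rigidity for pairs of representations of the SQUARE** (dimension exactly `2` on
both sides: the lower dimensions cost nothing, by padding). [cite: KontsevichZagier2001, §1.2 Conjecture 1] -/
theorem stub_boxRigidity_var2205_iff_dim_two :
    (∀ (m m' : ℕ) (N : IntegralRep m) (N' : IntegralRep m'), m' ≤ 2 → m ≤ 2 → N.domain = {x | ∀ i, x i ∈ Set.Ioo (0:ℝ) 1} → N.IsRational → N'.domain = {x | ∀ i, x i ∈ Set.Ioo (0:ℝ) 1} → N'.IsRational → N.value = N'.value → Equivalent N N') ↔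
    (∀ N N' : IntegralRep 2,
      N.domain = {x | ∀ i, x i ∈ Set.Ioo (0:ℝ) 1} → N.IsRational →
      N'.domain = {x | ∀ i, x i ∈ Set.Ioo (0:ℝ) 1} → N'.IsRational →
      N.value = N'.value → Equivalent N N') :=
  ⟨fun h N N' => h 2 2 N N' le_rfl le_rfl,
    fun h _ _ N N' hm' hm => rigidityLe_of_vanishingAt 2 (vanishingAt_of_rigidityAt 2 h)
      hm hm' N N'⟩

/-- **V2205 ⟺ V2204** (the sibling `fix_nat:m=2; bound_nat:m'≤2`): both are BoxVanishing 2, so the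
whole certificate of file `…Variants2204` transfers. [cite: KontsevichZagier2001, §1.2 Conjecture 1] -/
theorem stub_boxRigidity_var2205_iff_var2204 :
    (∀ (m m' : ℕ) (N : IntegralRep m) (N' : IntegralRep m'), m' ≤ 2 → m ≤ 2 → N.domain = {x | ∀ i, x i ∈ Set.Ioo (0:ℝ) 1} → N.IsRational → N'.domain = {x | ∀ i, x i ∈ Set.Ioo (0:ℝ) 1} → N'.IsRational → N.value = N'.value → Equivalent N N') ↔
    (∀ (m' : ℕ) (N : IntegralRep 2) (N' : IntegralRep m'), m' ≤ 2 → N.domain = {x | ∀ i, x i ∈ Set.Ioo (0:ℝ) 1} → N.IsRational → N'.domain = {x | ∀ i, x i ∈ Set.Ioo (0:ℝ) 1} → N'.IsRational → N.value = N'.value → Equivalent N N') := by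
  rw [stub_boxRigidity_var2205_iff_boxVanishing_two]
  exact ⟨fun h _ N N' hm' => rigidityLe_of_vanishingAt 2 h le_rfl hm' N N',
    fun h => vanishingAt_of_rigidityAt 2 fun N N' => h 2 N N' le_rfl⟩

/-- **V2205 ⇒ BoxVanishing in every dimension `≤ 2`** (so V2205 contains the dimension-`≤ 1` kernel
statements, theorems of the tree by Baker, and adds exactly the square). [cite: KontsevichZagier2001, §1.2 Conjecture 1] -/
theorem boxVanishingLe_two_of_stub_boxRigidity_var2205
    (h : ∀ (m m' : ℕ) (N : IntegralRep m) (N' : IntegralRep m'), m' ≤ 2 → m ≤ 2 → N.domain = {x | ∀ i, x i ∈ Set.Ioo (0:ℝ) 1} → N.IsRational → N'.domain = {x | ∀ i, x i ∈ Set.Ioo (0:ℝ) 1} → N'.IsRational → N.value = N'.value → Equivalent N N')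
    {m : ℕ} (hm : m ≤ 2) (N : IntegralRep m) (hNd : N.domain = {x | ∀ i, x i ∈ Set.Ioo (0:ℝ) 1})
    (hNr : N.IsRational) (hv : N.value = 0) : of N ∈ relations :=
  vanishingLe_of_vanishingAt 2 (stub_boxRigidity_var2205_iff_boxVanishing_two.1 h) hm N hNd hNr hv

/-! ## Position: below the Summit and the parent; above every weight-two rung -/

/-- **Parent ⇒ V2205** (the variant is a specialisation of the leaf `stub_boxRigidity`; the converse is
not claimed — the parent is BoxVanishing in ALL dimensions). [cite: KontsevichZagier2001, §1.2 Conjecture 1] -/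
theorem stub_boxRigidity_var2205_of_parent
    (h : ∀ (m m' : ℕ) (N : IntegralRep m) (N' : IntegralRep m'), N.domain = {x | ∀ i, x i ∈ Set.Ioo (0:ℝ) 1} → N.IsRational → N'.domain = {x | ∀ i, x i ∈ Set.Ioo (0:ℝ) 1} → N'.IsRational → N.value = N'.value → Equivalent N N') :
    ∀ (m m' : ℕ) (N : IntegralRep m) (N' : IntegralRep m'), m' ≤ 2 → m ≤ 2 → N.domain = {x | ∀ i, x i ∈ Set.Ioo (0:ℝ) 1} → N.IsRational → N'.domain = {x | ∀ i, x i ∈ Set.Ioo (0:ℝ) 1} → N'.IsRational → N.value = N'.value → Equivalent N N' :=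
  fun m m' N N' _ _ => h m m' N N'

/-- **`KontsevichZagierPeriods ⇒ V2205`**: the variant is a special case of Conjecture 1 for the tree's
calculus — so a refutation of the variant would refute the Summit. [cite: KontsevichZagier2001, §1.2 Conjecture 1] -/
theorem stub_boxRigidity_var2205_of_statement (h : _root_.KontsevichZagierPeriods) :
    ∀ (m m' : ℕ) (N : IntegralRep m) (N' : IntegralRep m'), m' ≤ 2 → m ≤ 2 → N.domain = {x | ∀ i, x i ∈ Set.Ioo (0:ℝ) 1} → N.IsRational → N'.domain = {x | ∀ i, x i ∈ Set.Ioo (0:ℝ) 1} → N'.IsRational → N.value = N'.value → Equivalent N N' :=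
  stub_boxRigidity_var2205_of_parent (leaves_of_statement h).1

/-- **V2205 ⇒ Conjecture 1 on every weight-two Hurwitz sector of the square, with NO
linear-independence hypothesis** (`P(xy)/(1 − (xy)ᴸ)`, `L ≠ 0`; as for V2204). The route closes such
rungs one level at a time and only given the matching independence theorem (level 6:
Calegari–Dimitrov–Tang; level 4: `Indep_ℚ(1, π², G)`, open) — this is where the variant is open.
[cite: KontsevichZagier2001, §1.2 Conjecture 1] -/
theorem sectorTwo_of_stub_boxRigidity_var2205
    (h : ∀ (m m' : ℕ) (N : IntegralRep m) (N' : IntegralRep m'), m' ≤ 2 → m ≤ 2 → N.domain = {x | ∀ i, x i ∈ Set.Ioo (0:ℝ) 1} → N.IsRational → N'.domain = {x | ∀ i, x i ∈ Set.Ioo (0:ℝ) 1} → N'.IsRational → N.value = N'.value → Equivalent N N')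
    (L : ℕ) (hL : L ≠ 0) :
    ∀ (r r' : IntegralRep 2) (P P' : Polynomial ℚ), r.domain = {x | ∀ i, x i ∈ Set.Ioo (0:ℝ) 1} →
      r'.domain = {x | ∀ i, x i ∈ Set.Ioo (0:ℝ) 1} →
      EqOn r.integrand (fun x => Polynomial.aeval (x 0 * x 1) P / (1 - (x 0 * x 1) ^ L)) r.domain →
      EqOn r'.integrand (fun x => Polynomial.aeval (x 0 * x 1) P' / (1 - (x 0 * x 1) ^ L)) r'.domain →
      r.value = r'.value → Equivalent r r' :=
  fun r r' P P' hr hr' hP hP' hv =>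
    h 2 2 r r' le_rfl le_rfl hr (isRational_sectorTwo L hL r P hr hP) hr'
      (isRational_sectorTwo L hL r' P' hr' hP') hv

/-- **V2205 ⇒ the Catalan rung unconditionally**: the CONCLUSION of the route item
`CatalanSectorTwoFour` (level 4, weight 2) without its open hypothesis `Indep_ℚ(1, π², G)`.
[cite: KontsevichZagier2001, §1.2 Conjecture 1] -/
theorem catalanSector_unconditional_of_stub_boxRigidity_var2205
    (h : ∀ (m m' : ℕ) (N : IntegralRep m) (N' : IntegralRep m'), m' ≤ 2 → m ≤ 2 → N.domain = {x | ∀ i, x i ∈ Set.Ioo (0:ℝ) 1} → N.IsRational → N'.domain = {x | ∀ i, x i ∈ Set.Ioo (0:ℝ) 1} → N'.IsRational → N.value = N'.value → Equivalent N N') :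
    ∀ (r r' : IntegralRep 2) (P P' : Polynomial ℚ), r.domain = {x | ∀ i, x i ∈ Set.Ioo (0:ℝ) 1} →
      r'.domain = {x | ∀ i, x i ∈ Set.Ioo (0:ℝ) 1} →
      EqOn r.integrand (fun x => Polynomial.aeval (x 0 * x 1) P / (1 - (x 0 * x 1) ^ 4)) r.domain →
      EqOn r'.integrand (fun x => Polynomial.aeval (x 0 * x 1) P' / (1 - (x 0 * x 1) ^ 4)) r'.domain →
      r.value = r'.value → Equivalent r r' :=
  sectorTwo_of_stub_boxRigidity_var2205 h 4 (by norm_num)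

end Summit.KontsevichZagierPeriods.KontsevichZagierPeriods.Theorems
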